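import Summits.NavierStokesRegularity.NavierStokesRegularity.Theorems.PerpetualPumpThesisBesovDuhamelBoundSymbols
import Literature.Analysis.FluidPDE.TaoAveragedSlotFourier

/-!
# Stub `besovDuhamelBound` for `PerpetualPump.Thesis`, part V: the `L¹` kernel of the test
# symbol `ζ_j m(aζ) e^{-(2π)²r|ζ|²} φ₀(R⁻¹ζ) (R_ℂ P(R⁻¹ζ) e_i)_l`

Support file (part 5 of the stub `besovDuhamelBound` of line `SketchIdeator2`, crux
stmt-NavierStokesRegularity-1832). In the Besov–Duhamel estimate the nonlinearity of Tao's
averaged equation (J. Amer. Math. Soc. 29 (2016), (1.12)–(1.15)) is tested, block by block, against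
the fields `H = m₃(D) Rot_R Dil_λ e^{σΔ} P Δ̇_k δ_x e_i`, and the physical-space Euler bound of
part IV asks for `‖𝓕⁻¹[ξ_j Ĥ_l]‖_{L¹}`. After rescaling `ξ = 2ᵏλ ζ` and translating, `ξ_j Ĥ_l(ξ)`
is (a phase times a constant times) the fixed-scale symbol
`Θ(ζ) = ζ_j · m₃(aζ) · e^{-(2π)² r ‖ζ‖²} · φ₀(R⁻¹ζ) · (R_ℂ P(R⁻¹ζ) e_i)_l` (`a = 2ᵏλ`, `r = σ 4ᵏ`,
`P(η) = 1 - η ⊗ η/|η|²` the Leray symbol); this file proves (`FA.exists_thetaKernel`) that **`Θ` is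
a Schwartz function with `‖𝓕⁻¹Θ‖_{L¹} ≤ C (∑_{i ≤ n} ‖m₃‖_i) e^{-π² r/8}`**, uniformly in `a > 0`,
`r ≥ 0`, `R` and the indices (five smooth factors with controlled derivatives on the annulus
`1/4 ≤ |ζ| ≤ 4`, cut off by the reproducing symbol `ψ`, and the `L¹`-kernel lemma of part II).

References: H. Bahouri, J.-Y. Chemin, R. Danchin, *Fourier Analysis and Nonlinear PDE* (2011),
Lemmas 2.1, 2.2, 2.4; T. Tao, J. Amer. Math. Soc. 29 (2016), 601–674, §1.1.
-/

noncomputable section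

open MeasureTheory TemperedDistribution SchwartzMap Filter Topology Function FourierTransform
open scoped SchwartzMap ENNReal NNReal Real ContDiff

set_option linter.dupNamespace false

namespace Summit.NavierStokesRegularity.NavierStokesRegularity.Theorems.PerpetualPumpThesis.FA

open Literature.Analysis.FunctionSpaces Literature.Analysis.FluidPDE
  Literature.Analysis.FluidPDE.Tao2016

/-! ### The truncated Leray vector `ψ(η) P(η) e_i` is smooth with compact support -/

/-- `ψ(η)/‖η‖²` is smooth on `ℝ³` (`ψ` vanishes near the origin). -/
theorem contDiff_bernstein_mul_inv_norm_sq :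
    ContDiff ℝ ∞ (fun η : EuclideanSpace ℝ (Fin 3) =>
      (((‖η‖ ^ 2 : ℝ) : ℂ))⁻¹ * bernsteinSymbol η) := by
  have hσ : ContDiffOn ℝ ∞ (fun η : EuclideanSpace ℝ (Fin 3) => (((‖η‖ ^ 2 : ℝ) : ℂ))⁻¹) {0}ᶜ := by
    refine ContDiffOn.inv ?_ fun η hη => ?_
    · exact (Complex.ofRealCLM.contDiff.comp (contDiff_norm_sq ℝ)).contDiffOn
    · have hη' : η ≠ 0 := hη
      exact_mod_cast (pow_pos (norm_pos_iff.2 hη') 2).ne'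
  exact contDiff_mul_of_tsupport_subset isOpen_compl_singleton hσ contDiff_bernsteinSymbol
    (tsupport_bernsteinSymbol_subset.trans fun η hη h0 => by
      rw [Set.mem_singleton_iff] at h0
      rw [h0, Set.mem_setOf_eq, norm_zero] at hη
      norm_num at hη)

/-- **The truncated Leray vector is smooth**:
`η ↦ ψ(η) (e_i - (η_i/|η|²) η)` is `C^∞` on `ℝ³` (values in `ℂ³`). -/
theorem contDiff_bernstein_smul_lerayVec (i : Fin 3) :
    ContDiff ℝ ∞ (fun η : EuclideanSpace ℝ (Fin 3) => bernsteinSymbol η •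
      (EuclideanSpace.single i (1 : ℂ) -
        (EuclideanSpace.complexify η i / ((‖η‖ ^ 2 : ℝ) : ℂ)) • EuclideanSpace.complexify η)) := by
  have hproj : ContDiff ℝ ∞ (fun η : EuclideanSpace ℝ (Fin 3) => EuclideanSpace.complexify η i) := by
    have : (fun η : EuclideanSpace ℝ (Fin 3) => EuclideanSpace.complexify η i) =
        fun η => ((η i : ℝ) : ℂ) := funext fun η => EuclideanSpace.complexify_apply η i
    rw [this]
    exact Complex.ofRealCLM.contDiff.comp (EuclideanSpace.proj (𝕜 := ℝ) i).contDiff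
  have hc : ContDiff ℝ ∞ (fun η : EuclideanSpace ℝ (Fin 3) => EuclideanSpace.complexify η) :=
    (EuclideanSpace.complexify (ι := Fin 3) :
      EuclideanSpace ℝ (Fin 3) →ₗᵢ[ℝ] EuclideanSpace ℂ (Fin 3)).toContinuousLinearMap.contDiff
  have hfun : (fun η : EuclideanSpace ℝ (Fin 3) => bernsteinSymbol η •
      (EuclideanSpace.single i (1 : ℂ) -
        (EuclideanSpace.complexify η i / ((‖η‖ ^ 2 : ℝ) : ℂ)) • EuclideanSpace.complexify η)) =
      fun η => bernsteinSymbol η • EuclideanSpace.single i (1 : ℂ) -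
        (((((‖η‖ ^ 2 : ℝ) : ℂ))⁻¹ * bernsteinSymbol η) * EuclideanSpace.complexify η i) •
          EuclideanSpace.complexify η := by
    funext η
    rw [smul_sub, smul_smul, div_eq_mul_inv]
    congr 2
    ring
  rw [hfun]
  exact (contDiff_bernsteinSymbol.smul contDiff_const).sub
    ((contDiff_bernstein_mul_inv_norm_sq.mul hproj).smul hc)

/-- The truncated Leray vector has compact support (that of `ψ`). -/
theorem hasCompactSupport_bernstein_smul_lerayVec (i : Fin 3) :
    HasCompactSupport (fun η : EuclideanSpace ℝ (Fin 3) => bernsteinSymbol η •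
      (EuclideanSpace.single i (1 : ℂ) -
        (EuclideanSpace.complexify η i / ((‖η‖ ^ 2 : ℝ) : ℂ)) • EuclideanSpace.complexify η)) :=
  hasCompactSupport_bernsteinSymbol.smul_right

/-- **Uniform derivative bounds for the truncated Leray vectors**: for every `n` there is `Q₅`
with `‖Dᴺ[ψ P e_i](η)‖ ≤ Q₅` for all `i`, `N ≤ n`, `η` (a compactly supported smooth field is a
Schwartz function). -/
theorem exists_norm_iteratedFDeriv_bernstein_smul_lerayVec_le (n : ℕ) :
    ∃ Q₅ : ℝ, 0 ≤ Q₅ ∧ ∀ (i : Fin 3) (N : ℕ), N ≤ n → ∀ η : EuclideanSpace ℝ (Fin 3),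
      ‖iteratedFDeriv ℝ N (fun η : EuclideanSpace ℝ (Fin 3) => bernsteinSymbol η •
        (EuclideanSpace.single i (1 : ℂ) -
          (EuclideanSpace.complexify η i / ((‖η‖ ^ 2 : ℝ) : ℂ)) • EuclideanSpace.complexify η)) η‖ ≤
        Q₅ := by
  set S : Fin 3 → 𝓢(EuclideanSpace ℝ (Fin 3), EuclideanSpace ℂ (Fin 3)) := fun i =>
    (hasCompactSupport_bernstein_smul_lerayVec i).toSchwartzMap (contDiff_bernstein_smul_lerayVec i)
    with hS
  set B : Fin 3 → ℝ := fun i => (Finset.Iic ((0 : ℕ), n)).sup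
    (schwartzSeminormFamily ℂ (EuclideanSpace ℝ (Fin 3)) (EuclideanSpace ℂ (Fin 3))) (S i) with hB
  have hB0 : ∀ i, 0 ≤ B i := fun i => apply_nonneg _ _
  refine ⟨∑ i, B i, Finset.sum_nonneg fun i _ => hB0 i, fun i N hN η => ?_⟩
  have h1 : ‖iteratedFDeriv ℝ N (⇑(S i)) η‖ ≤ B i := by
    have := le_seminorm ℂ 0 N (S i) η
    rw [pow_zero, one_mul] at this
    refine this.trans (Seminorm.le_def.1 (Finset.le_sup
      (f := schwartzSeminormFamily ℂ (EuclideanSpace ℝ (Fin 3)) (EuclideanSpace ℂ (Fin 3)))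
      (Finset.mem_Iic.2 (Prod.mk_le_mk.2 ⟨le_rfl, hN⟩))) _)
  have hcoe : (⇑(S i) : EuclideanSpace ℝ (Fin 3) → EuclideanSpace ℂ (Fin 3)) =
      fun η : EuclideanSpace ℝ (Fin 3) => bernsteinSymbol η •
        (EuclideanSpace.single i (1 : ℂ) -
          (EuclideanSpace.complexify η i / ((‖η‖ ^ 2 : ℝ) : ℂ)) • EuclideanSpace.complexify η) := rfl
  rw [hcoe] at h1
  exact h1.trans (Finset.single_le_sum (f := B) (fun j _ => hB0 j) (Finset.mem_univ i))

/-! ### The rotated coordinate of the truncated Leray vector -/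

/-- The complexified rotation has operator norm `≤ 1`. -/
theorem norm_complexifyCLM_le_one (R : EuclideanSpace ℝ (Fin 3) ≃ₗᵢ[ℝ] EuclideanSpace ℝ (Fin 3)) :
    ‖complexifyCLM R.toLinearIsometry.toContinuousLinearMap‖ ≤ 1 :=
  ContinuousLinearMap.opNorm_le_bound _ zero_le_one fun V => by
    rw [norm_complexifyCLM, one_mul]

/-- **The factor `g₅(ζ) = (R_ℂ Q(R⁻¹ζ))_l`** for a smooth compactly supported field `Q` (here
the truncated Leray vector `ψ P e_i`): smooth, compactly supported, with the derivative bounds of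
`Q` (composition with the isometries `R⁻¹` on the right and `e_l* ∘ R_ℂ` on the left). -/
theorem rotate_coord_props {n : ℕ} {Q₅ : ℝ} {Q : EuclideanSpace ℝ (Fin 3) → EuclideanSpace ℂ (Fin 3)}
    (hQs : ContDiff ℝ ∞ Q) (hQc : HasCompactSupport Q)
    (hQ : ∀ N ≤ n, ∀ η : EuclideanSpace ℝ (Fin 3), ‖iteratedFDeriv ℝ N Q η‖ ≤ Q₅)
    (R : EuclideanSpace ℝ (Fin 3) ≃ₗᵢ[ℝ] EuclideanSpace ℝ (Fin 3)) (l : Fin 3) :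
    ContDiff ℝ ∞ (fun ζ : EuclideanSpace ℝ (Fin 3) =>
        (complexifyCLM R.toLinearIsometry.toContinuousLinearMap (Q (R.symm ζ))) l) ∧
      HasCompactSupport (fun ζ : EuclideanSpace ℝ (Fin 3) =>
        (complexifyCLM R.toLinearIsometry.toContinuousLinearMap (Q (R.symm ζ))) l) ∧
      ∀ N ≤ n, ∀ ζ : EuclideanSpace ℝ (Fin 3),
        ‖iteratedFDeriv ℝ N (fun ζ : EuclideanSpace ℝ (Fin 3) =>
          (complexifyCLM R.toLinearIsometry.toContinuousLinearMap (Q (R.symm ζ))) l) ζ‖ ≤ Q₅ := by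
  set L₁ : EuclideanSpace ℝ (Fin 3) →L[ℝ] EuclideanSpace ℝ (Fin 3) :=
    R.symm.toLinearIsometry.toContinuousLinearMap with hL₁
  set L₂ : EuclideanSpace ℂ (Fin 3) →L[ℝ] ℂ :=
    ((EuclideanSpace.proj (𝕜 := ℂ) l).comp
      (complexifyCLM R.toLinearIsometry.toContinuousLinearMap)).restrictScalars ℝ with hL₂
  have hfun : (fun ζ : EuclideanSpace ℝ (Fin 3) =>
      (complexifyCLM R.toLinearIsometry.toContinuousLinearMap (Q (R.symm ζ))) l) =
        ⇑L₂ ∘ (Q ∘ ⇑L₁) := by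
    funext ζ
    rfl
  have hQL₁ : ContDiff ℝ ∞ (Q ∘ ⇑L₁) := hQs.comp L₁.contDiff
  have hL₁n : ‖L₁‖ ≤ 1 := by
    rw [hL₁]
    exact R.symm.toLinearIsometry.norm_toContinuousLinearMap_le
  have hL₂n : ‖L₂‖ ≤ 1 := by
    rw [hL₂, ContinuousLinearMap.norm_restrictScalars]
    refine (ContinuousLinearMap.opNorm_comp_le _ _).trans ?_
    calc ‖EuclideanSpace.proj (𝕜 := ℂ) (ι := Fin 3) l‖ *
          ‖complexifyCLM R.toLinearIsometry.toContinuousLinearMap‖ ≤ 1 * 1 := by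
          gcongr
          · exact ContinuousLinearMap.opNorm_le_bound _ zero_le_one fun V => by
              rw [one_mul]; exact PiLp.norm_apply_le V l
          · exact norm_complexifyCLM_le_one R
      _ = 1 := one_mul _
  rw [hfun]
  refine ⟨L₂.contDiff.comp hQL₁, ?_, fun N hN ζ => ?_⟩
  · refine HasCompactSupport.comp_left ?_ (map_zero L₂)
    exact hQc.comp_homeomorph R.symm.toContinuousLinearEquiv.toHomeomorph
  · rw [L₂.iteratedFDeriv_comp_left hQL₁.contDiffAt (mod_cast le_top)]
    refine (ContinuousLinearMap.norm_compContinuousMultilinearMap_le _ _).trans ?_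
    rw [L₁.iteratedFDeriv_comp_right hQs ζ (mod_cast le_top)]
    have h3 := (ContinuousMultilinearMap.norm_compContinuousLinearMap_le
      (iteratedFDeriv ℝ N Q (L₁ ζ)) (fun _ => L₁))
    rw [Finset.prod_const, Finset.card_univ, Fintype.card_fin] at h3
    have hQ0 : 0 ≤ Q₅ := (norm_nonneg _).trans (hQ 0 (Nat.zero_le _) 0)
    calc ‖L₂‖ * ‖(iteratedFDeriv ℝ N Q (L₁ ζ)).compContinuousLinearMap fun _ => L₁‖
        ≤ 1 * (Q₅ * 1) := by
          refine mul_le_mul hL₂n (h3.trans ?_) (norm_nonneg _) zero_le_one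
          exact mul_le_mul (hQ N hN _) ((pow_le_one₀ (norm_nonneg _) hL₁n).trans le_rfl)
            (by positivity) hQ0
      _ = Q₅ := by ring

/-! ### The symbol at scale `a`: smoothness off the origin -/

/-- Dilating the argument of a function smooth off the origin keeps it smooth off the origin. -/
theorem contDiffOn_comp_smul {m : EuclideanSpace ℝ (Fin 3) → ℂ} (hm : ContDiffOn ℝ ∞ m {0}ᶜ)
    {a : ℝ} (ha : 0 < a) : ContDiffOn ℝ ∞ (fun ζ : EuclideanSpace ℝ (Fin 3) => m (a • ζ)) {0}ᶜ := by
  set g : EuclideanSpace ℝ (Fin 3) →L[ℝ] EuclideanSpace ℝ (Fin 3) := a • ContinuousLinearMap.id ℝ _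
  have hpre : ⇑g ⁻¹' ({0}ᶜ : Set (EuclideanSpace ℝ (Fin 3))) = {0}ᶜ := by
    ext y
    simp [g, ha.ne']
  have : (fun ζ : EuclideanSpace ℝ (Fin 3) => m (a • ζ)) = m ∘ ⇑g := rfl
  rw [this, ← hpre]
  exact hm.comp g.contDiff.contDiffOn fun y hy => hy

/-- `(m(a ·))_0 = m(a ·) ψ`: the block truncation at frequency `1` of the dilated symbol. -/
theorem truncSymbol_comp_smul_zero_apply (m : EuclideanSpace ℝ (Fin 3) → ℂ) (a : ℝ)
    (ζ : EuclideanSpace ℝ (Fin 3)) :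
    truncSymbol (fun ζ : EuclideanSpace ℝ (Fin 3) => m (a • ζ)) 0 ζ = m (a • ζ) * bernsteinSymbol ζ := by
  rw [truncSymbol_apply, neg_zero, zpow_zero, one_smul]

/-! ### The kernel bound -/

/-- The support of `φ₀ ∘ R⁻¹`: if `φ₀(R⁻¹ζ) ≠ 0` then `1/2 < ‖ζ‖ < 2`, so `ψ(ζ) = ψ(R⁻¹ζ) = 1`. -/
theorem bernstein_eq_one_of_dyadicSymbol_comp_ne_zero
    (R : EuclideanSpace ℝ (Fin 3) ≃ₗᵢ[ℝ] EuclideanSpace ℝ (Fin 3)) {ζ : EuclideanSpace ℝ (Fin 3)}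
    (h : dyadicSymbol 0 (R.symm ζ) ≠ 0) :
    bernsteinSymbol ζ = 1 ∧ bernsteinSymbol (R.symm ζ) = 1 := by
  have hn : ‖R.symm ζ‖ = ‖ζ‖ := R.symm.norm_map ζ
  have h1 : 2⁻¹ < ‖R.symm ζ‖ := by
    by_contra hle
    refine h (dyadicSymbol_apply_of_norm_le_holds ?_)
    simpa using not_lt.1 hle
  have h2 : ‖R.symm ζ‖ < 2 := by
    by_contra hle
    refine h (dyadicSymbol_apply_of_le_norm_holds ?_)
    simpa using not_lt.1 hle
  exact ⟨bernsteinSymbol_eq_one (by rw [← hn]; exact h1.le) (by rw [← hn]; exact h2.le),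
    bernsteinSymbol_eq_one h1.le h2.le⟩

/-- **The test kernel is a Schwartz function with an `L¹` bound linear in `∑ ‖m‖_i` and
decaying like `e^{-π² r/8}`.** There are an order `n` and a constant `C` such that for every real
order-`0` symbol `m ∈ 𝓜₀`, every dilation `a > 0`, every `r ≥ 0`, every rotation `R` of `ℝ³` and
all indices `i, j, l`, the symbol
`Θ(ζ) = ζ_j m(aζ) e^{-(2π)² r ‖ζ‖²} φ₀(R⁻¹ζ) (R_ℂ P(R⁻¹ζ) e_i)_l` (`P(η)v = v - (η·v/|η|²) η` the
Leray symbol) is a Schwartz function `Θ` with `‖𝓕⁻¹Θ‖_{L¹} ≤ C (∑_{i≤n} ‖m‖_i) e^{-π² r/8}`. -/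
theorem exists_thetaKernel :
    ∃ (n : ℕ) (C : ℝ≥0), ∀ (m : EuclideanSpace ℝ (Fin 3) → ℂ), IsRealSymbol m →
      ∀ (a : ℝ), 0 < a → ∀ (r : ℝ), 0 ≤ r →
      ∀ (R : EuclideanSpace ℝ (Fin 3) ≃ₗᵢ[ℝ] EuclideanSpace ℝ (Fin 3)) (i j l : Fin 3),
      ∃ Θ : 𝓢(EuclideanSpace ℝ (Fin 3), ℂ),
        (∀ ζ : EuclideanSpace ℝ (Fin 3), Θ ζ =
          EuclideanSpace.complexify ζ j * m (a • ζ) *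
            ((Literature.Analysis.UnboundedOperators.heatSymbol r ζ : ℝ) : ℂ) *
            dyadicSymbol 0 (R.symm ζ) *
            (complexifyCLM R.toLinearIsometry.toContinuousLinearMap
              (EuclideanSpace.single i (1 : ℂ) -
                (EuclideanSpace.complexify (R.symm ζ) i / ((‖R.symm ζ‖ ^ 2 : ℝ) : ℂ)) •
                  EuclideanSpace.complexify (R.symm ζ))) l) ∧
        eLpNorm (⇑(𝓕⁻ Θ : 𝓢(EuclideanSpace ℝ (Fin 3), ℂ))) 1 volume ≤
          C * ENNReal.ofReal (∑ i ∈ Finset.range (n + 1), (symbolSeminorm i m).toReal) *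
            ENNReal.ofReal (Real.exp (-(π ^ 2 / 8) * r)) := by
  -- the order and the constants
  obtain ⟨n, C₀, hC₀⟩ := exists_eLpNorm_fourierInv_smulLeftCLM_bernstein_le (E := EuclideanSpace ℝ (Fin 3))
  obtain ⟨K₀, hK₀0, hK₀⟩ := exists_norm_iteratedFDeriv_rescaled_mul_bernstein_le
    (E := EuclideanSpace ℝ (Fin 3)) n
  obtain ⟨Ch, hCh0, hCh⟩ := norm_iteratedFDeriv_heatSymbol_le_exp_neg (E := EuclideanSpace ℝ (Fin 3))
    (by norm_num : (0 : ℝ) < 4⁻¹) 4 n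
  obtain ⟨Q₄, hQ₄0, hQ₄⟩ := exists_norm_iteratedFDeriv_dyadicSymbol_comp_le (E := EuclideanSpace ℝ (Fin 3)) n
  obtain ⟨Q₅, hQ₅0, hQ₅⟩ := exists_norm_iteratedFDeriv_bernstein_smul_lerayVec_le n
  refine ⟨n, C₀ * (((2 : ℝ) ^ n) ^ 4 * 4 * K₀ * Ch * Q₄ * Q₅).toNNReal,
    fun m hm a ha r hr R i j l => ?_⟩
  have h2i : ∀ i ≤ n, (2 : ℝ) ^ i ≤ (2 : ℝ) ^ n := fun i hi => pow_le_pow_right₀ one_le_two hi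
  set S : ℝ := ∑ i ∈ Finset.range (n + 1), (symbolSeminorm i m).toReal with hS
  have hS0 : 0 ≤ S := Finset.sum_nonneg fun i _ => ENNReal.toReal_nonneg
  have habs : ∑ i ∈ Finset.range (n + 1), |(symbolSeminorm i m).toReal| = S :=
    Finset.sum_congr rfl fun i _ => abs_of_nonneg ENNReal.toReal_nonneg
  -- the five factors
  set g₁ : EuclideanSpace ℝ (Fin 3) → ℂ := fun ζ => EuclideanSpace.complexify ζ j with hg₁
  set g₂ : EuclideanSpace ℝ (Fin 3) → ℂ := truncSymbol (fun ζ : EuclideanSpace ℝ (Fin 3) => m (a • ζ)) 0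
    with hg₂
  set g₃ : EuclideanSpace ℝ (Fin 3) → ℂ := fun ζ =>
    ((Literature.Analysis.UnboundedOperators.heatSymbol r ζ : ℝ) : ℂ) with hg₃
  set g₄ : EuclideanSpace ℝ (Fin 3) → ℂ := fun ζ => dyadicSymbol 0 (R.symm ζ) with hg₄
  set g₅ : EuclideanSpace ℝ (Fin 3) → ℂ := fun ζ =>
    (complexifyCLM R.toLinearIsometry.toContinuousLinearMap
      (bernsteinSymbol (R.symm ζ) • (EuclideanSpace.single i (1 : ℂ) -
        (EuclideanSpace.complexify (R.symm ζ) i / ((‖R.symm ζ‖ ^ 2 : ℝ) : ℂ)) •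
          EuclideanSpace.complexify (R.symm ζ)))) l with hg₅
  -- factor 1: a linear form
  set L₁ : EuclideanSpace ℝ (Fin 3) →L[ℝ] ℂ := Complex.ofRealCLM.comp (EuclideanSpace.proj (𝕜 := ℝ) j)
    with hL₁
  have hg₁L : g₁ = ⇑L₁ := funext fun ζ => EuclideanSpace.complexify_apply ζ j
  have hL₁n : ‖L₁‖ ≤ 1 := by
    refine (ContinuousLinearMap.opNorm_comp_le _ _).trans ?_
    calc ‖Complex.ofRealCLM‖ * ‖EuclideanSpace.proj (𝕜 := ℝ) (ι := Fin 3) j‖ ≤ 1 * 1 := by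
          gcongr
          · exact Complex.ofRealLI.norm_toContinuousLinearMap_le
          · exact ContinuousLinearMap.opNorm_le_bound _ zero_le_one fun V => by
              rw [one_mul]; exact PiLp.norm_apply_le V j
      _ = 1 := one_mul _
  have hg₁t : g₁.HasTemperateGrowth := by rw [hg₁L]; exact L₁.hasTemperateGrowth
  have hg₁s : ContDiff ℝ ∞ g₁ := by rw [hg₁L]; exact L₁.contDiff
  have hg₁b : ∀ N ≤ n, ∀ x ∈ blockAnnulus (EuclideanSpace ℝ (Fin 3)), ‖iteratedFDeriv ℝ N g₁ x‖ ≤ 4 := by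
    intro N _ x hx
    rw [hg₁L]
    refine (norm_iteratedFDeriv_clm_apply_le L₁ x N).trans (max_le ?_ (hL₁n.trans (by norm_num)))
    calc ‖L₁‖ * ‖x‖ ≤ 1 * 4 := mul_le_mul hL₁n hx.2 (norm_nonneg _) zero_le_one
      _ = 4 := one_mul _
  -- factor 2: the truncated dilated symbol
  have hmc : ContDiffOn ℝ ∞ (fun ζ : EuclideanSpace ℝ (Fin 3) => m (a • ζ)) {0}ᶜ :=
    contDiffOn_comp_smul (contDiffOn_of_isRealSymbol hm) ha
  have hg₂t : g₂.HasTemperateGrowth := hasTemperateGrowth_truncSymbol hmc 0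
  have hg₂s : ContDiff ℝ ∞ g₂ := contDiff_truncSymbol hmc 0
  have hg₂b : ∀ N ≤ n, ∀ x ∈ blockAnnulus (EuclideanSpace ℝ (Fin 3)),
      ‖iteratedFDeriv ℝ N g₂ x‖ ≤ K₀ * S := by
    intro N hN x hx
    have hfun : g₂ = fun ζ => m (a • ζ) * bernsteinSymbol ζ :=
      funext fun ζ => truncSymbol_comp_smul_zero_apply m a ζ
    rw [hfun, ← habs]
    exact hK₀ m (contDiffOn_of_isRealSymbol hm) (fun i => (symbolSeminorm i m).toReal)
      (fun N _ ξ hξ => norm_iteratedFDeriv_le_of_isRealSymbol hm N ξ hξ) a ha N hN x hx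
  -- factor 3: the Gaussian
  have hg₃t : g₃.HasTemperateGrowth :=
    Literature.Analysis.UnboundedOperators.heatSymbol_hasTemperateGrowth_complex
      Literature.Analysis.UnboundedOperators.heatSymbol_hasTemperateGrowth_holds hr
  have hg₃s : ContDiff ℝ ∞ g₃ := hg₃t.1
  have hg₃b : ∀ N ≤ n, ∀ x ∈ blockAnnulus (EuclideanSpace ℝ (Fin 3)),
      ‖iteratedFDeriv ℝ N g₃ x‖ ≤ Ch * Real.exp (-(π ^ 2 / 8) * r) := by
    intro N hN x hx
    have := hCh r hr N hN x hx.1 hx.2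
    rwa [heatBernstein_rate] at this
  -- factor 4: the rotated bump
  set L₄ : EuclideanSpace ℝ (Fin 3) →L[ℝ] EuclideanSpace ℝ (Fin 3) :=
    R.symm.toLinearIsometry.toContinuousLinearMap with hL₄
  have hg₄L : g₄ = fun ζ => dyadicSymbol 0 (L₄ ζ) := rfl
  have hL₄n : ‖L₄‖ ≤ 1 := R.symm.toLinearIsometry.norm_toContinuousLinearMap_le
  have hg₄s : ContDiff ℝ ∞ g₄ := (contDiff_dyadicSymbol 0).comp L₄.contDiff
  have hg₄t : g₄.HasTemperateGrowth :=
    ((hasCompactSupport_dyadicSymbol 0).comp_homeomorph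
      R.symm.toContinuousLinearEquiv.toHomeomorph).hasTemperateGrowth hg₄s
  have hg₄b : ∀ N ≤ n, ∀ x ∈ blockAnnulus (EuclideanSpace ℝ (Fin 3)), ‖iteratedFDeriv ℝ N g₄ x‖ ≤ Q₄ := by
    intro N hN x _
    rw [hg₄L]
    refine (hQ₄ L₄ N hN x).trans ?_
    rw [max_eq_left hL₄n, one_pow, mul_one]
  -- factor 5: the rotated truncated Leray coordinate
  obtain ⟨hg₅s, hg₅c, hg₅b'⟩ := rotate_coord_props (contDiff_bernstein_smul_lerayVec i)
    (hasCompactSupport_bernstein_smul_lerayVec i) (hQ₅ i) R l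
  have hg₅t : g₅.HasTemperateGrowth := hg₅c.hasTemperateGrowth hg₅s
  have hg₅b : ∀ N ≤ n, ∀ x ∈ blockAnnulus (EuclideanSpace ℝ (Fin 3)), ‖iteratedFDeriv ℝ N g₅ x‖ ≤ Q₅ :=
    fun N hN x _ => hg₅b' N hN x
  -- the product and its derivative bound on the annulus
  set G : EuclideanSpace ℝ (Fin 3) → ℂ := fun ζ => g₁ ζ * g₂ ζ * g₃ ζ * g₄ ζ * g₅ ζ with hG
  have hGt : G.HasTemperateGrowth := (((hg₁t.mul hg₂t).mul hg₃t).mul hg₄t).mul hg₅t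
  set E₃ : ℝ := Real.exp (-(π ^ 2 / 8) * r) with hE₃
  have hE₃0 : 0 ≤ E₃ := (Real.exp_pos _).le
  have hGb : ∀ N ≤ n, ∀ x ∈ blockAnnulus (EuclideanSpace ℝ (Fin 3)),
      ‖iteratedFDeriv ℝ N G x‖ ≤ ((2 : ℝ) ^ n) ^ 4 * 4 * (K₀ * S) * (Ch * E₃) * Q₄ * Q₅ := by
    intro N hN x hx
    have hKS : 0 ≤ K₀ * S := mul_nonneg hK₀0 hS0
    have hCE : 0 ≤ Ch * E₃ := mul_nonneg hCh0 hE₃0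
    have h12 : ∀ i ≤ n, ‖iteratedFDeriv ℝ i (fun ζ => g₁ ζ * g₂ ζ) x‖ ≤ (2 : ℝ) ^ n * 4 * (K₀ * S) :=
      fun i hi => (norm_iteratedFDeriv_mul_le_of_le hg₁s hg₂s x (fun i hi => hg₁b i hi x hx)
        (fun i hi => hg₂b i hi x hx) hi).trans
          (mul_le_mul_of_nonneg_right (mul_le_mul_of_nonneg_right (h2i i hi) (by norm_num)) hKS)
    have h123 : ∀ i ≤ n, ‖iteratedFDeriv ℝ i (fun ζ => g₁ ζ * g₂ ζ * g₃ ζ) x‖ ≤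
        (2 : ℝ) ^ n * ((2 : ℝ) ^ n * 4 * (K₀ * S)) * (Ch * E₃) :=
      fun i hi => (norm_iteratedFDeriv_mul_le_of_le (hg₁s.mul hg₂s) hg₃s x h12
        (fun i hi => hg₃b i hi x hx) hi).trans
          (mul_le_mul_of_nonneg_right (mul_le_mul_of_nonneg_right (h2i i hi) (by positivity)) hCE)
    have h1234 : ∀ i ≤ n, ‖iteratedFDeriv ℝ i (fun ζ => g₁ ζ * g₂ ζ * g₃ ζ * g₄ ζ) x‖ ≤
        (2 : ℝ) ^ n * ((2 : ℝ) ^ n * ((2 : ℝ) ^ n * 4 * (K₀ * S)) * (Ch * E₃)) * Q₄ :=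
      fun i hi => (norm_iteratedFDeriv_mul_le_of_le ((hg₁s.mul hg₂s).mul hg₃s) hg₄s x h123
        (fun i hi => hg₄b i hi x hx) hi).trans
          (mul_le_mul_of_nonneg_right (mul_le_mul_of_nonneg_right (h2i i hi) (by positivity)) hQ₄0)
    have h12345 := norm_iteratedFDeriv_mul_le_of_le (((hg₁s.mul hg₂s).mul hg₃s).mul hg₄s) hg₅s x
      h1234 (fun i hi => hg₅b i hi x hx) hN
    refine h12345.trans ?_
    calc (2 : ℝ) ^ N * ((2 : ℝ) ^ n * ((2 : ℝ) ^ n * ((2 : ℝ) ^ n * 4 * (K₀ * S)) * (Ch * E₃)) * Q₄) * Q₅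
        ≤ (2 : ℝ) ^ n * ((2 : ℝ) ^ n * ((2 : ℝ) ^ n * ((2 : ℝ) ^ n * 4 * (K₀ * S)) * (Ch * E₃)) * Q₄) * Q₅ :=
          mul_le_mul_of_nonneg_right (mul_le_mul_of_nonneg_right (h2i N hN) (by positivity)) hQ₅0
      _ = ((2 : ℝ) ^ n) ^ 4 * 4 * (K₀ * S) * (Ch * E₃) * Q₄ * Q₅ := by ring
  -- the Schwartz function and its kernel
  set Θ : 𝓢(EuclideanSpace ℝ (Fin 3), ℂ) := SchwartzMap.smulLeftCLM ℂ G (bernsteinSchwartz (EuclideanSpace ℝ (Fin 3)))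
    with hΘ
  have hB0 : 0 ≤ ((2 : ℝ) ^ n) ^ 4 * 4 * (K₀ * S) * (Ch * E₃) * Q₄ * Q₅ := by positivity
  have hL1 := hC₀ G hGt _ hB0 hGb
  refine ⟨Θ, fun ζ => ?_, hL1.trans_eq ?_⟩
  · -- the pointwise formula
    rw [hΘ, SchwartzMap.smulLeftCLM_apply_apply hGt]
    have hψζ : (bernsteinSchwartz (EuclideanSpace ℝ (Fin 3)) : 𝓢(EuclideanSpace ℝ (Fin 3), ℂ)) ζ =
        bernsteinSymbol ζ := congrFun (coe_bernsteinSchwartz (E := EuclideanSpace ℝ (Fin 3))) ζ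
    rw [hψζ, smul_eq_mul, hG]
    simp only [hg₁, hg₂, hg₃, hg₄, hg₅, truncSymbol_comp_smul_zero_apply]
    by_cases h0 : dyadicSymbol 0 (R.symm ζ) = 0
    · rw [h0]; ring
    · obtain ⟨hψ, hψ'⟩ := bernstein_eq_one_of_dyadicSymbol_comp_ne_zero R h0
      rw [hψ, hψ', one_smul, mul_one, mul_one]
  · have hX0 : 0 ≤ ((2 : ℝ) ^ n) ^ 4 * 4 * K₀ * Ch * Q₄ * Q₅ := by positivity
    have e1 : ((2 : ℝ) ^ n) ^ 4 * 4 * (K₀ * S) * (Ch * E₃) * Q₄ * Q₅ =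
        (((2 : ℝ) ^ n) ^ 4 * 4 * K₀ * Ch * Q₄ * Q₅) * S * E₃ := by
      ring
    rw [e1, ENNReal.ofReal_mul (mul_nonneg hX0 hS0), ENNReal.ofReal_mul hX0, ENNReal.coe_mul]
    simp only [ENNReal.ofReal, mul_assoc]

end Summit.NavierStokesRegularity.NavierStokesRegularity.Theorems.PerpetualPumpThesis.FA

namespace Summit.NavierStokesRegularity.NavierStokesRegularity.Theorems.PerpetualPumpThesis

open Literature.Analysis.FluidPDE Literature.Analysis.FluidPDE.Tao2016
open Literature.Analysis.FunctionSpaces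

/-- **Part Kern of stub `besovDuhamelBound` (registered sub-goal `stub_FA_Kern`)**: the rescaled
test symbol `Θ(ζ) = ζ_j m(aζ) e^{-(2π)²r|ζ|²} φ₀(R⁻¹ζ) (R_ℂ P(R⁻¹ζ) e_i)_l` of the Besov–Duhamel
estimate is a Schwartz function with `‖𝓕⁻¹Θ‖_{L¹} ≤ C (∑_{i≤n} ‖m‖_i) e^{-π² r/8}`, uniformly in the
scale `a > 0`, the heat parameter `r ≥ 0`, the rotation and the indices. -/
theorem stub_FA_Kern : ∃ (n : ℕ) (C : NNReal), ∀ (m : EuclideanSpace ℝ (Fin 3) → ℂ), IsRealSymbol m → ∀ (a : ℝ), 0 < a → ∀ (r : ℝ), 0 ≤ r → ∀ (R : EuclideanSpace ℝ (Fin 3) ≃ₗᵢ[ℝ] EuclideanSpace ℝ (Fin 3)) (i j l : Fin 3), ∃ Θ : 𝓢(EuclideanSpace ℝ (Fin 3), ℂ), (∀ ζ : EuclideanSpace ℝ (Fin 3), Θ ζ = EuclideanSpace.complexify ζ j * m (a • ζ) * ((Literature.Analysis.UnboundedOperators.heatSymbol r ζ : ℝ) : ℂ) * dyadicSymbol 0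 (R.symm ζ) * (complexifyCLM R.toLinearIsometry.toContinuousLinearMap (EuclideanSpace.single i (1 : ℂ) - (EuclideanSpace.complexify (R.symm ζ) i / ((‖R.symm ζ‖ ^ 2 : ℝ) : ℂ)) • EuclideanSpace.complexify (R.symm ζ))) l) ∧ eLpNorm (⇑(FourierTransformInv.fourierInv Θ : 𝓢(EuclideanSpace ℝ (Fin 3), ℂ))) 1 volume ≤ (C : ENNReal) * ENNReal.ofReal (∑ i ∈ Finset.range (n + 1), (symbolSeminorm i m).toReal) * ENNReal.ofReal (Real.exp (-(Real.pi ^ 2 / 8) * r)) :=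
  FA.exists_thetaKernel

end Summit.NavierStokesRegularity.NavierStokesRegularity.Theorems.PerpetualPumpThesis
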